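import Literature.MathematicalPhysics.QuantumFieldTheory.Balaban1983to89.B8SockSP5ThresholdsSrc
import Literature.MathematicalPhysics.QuantumFieldTheory.Balaban1983to89.B8SockSP5ProviderSrcGamma
import Literature.MathematicalPhysics.QuantumFieldTheory.Balaban1983to89.B8SockSP5BaseSrcGamma
import Literature.MathematicalPhysics.QuantumFieldTheory.Balaban1983to89.B8SockSP5uProviderSrcGamma
import Literature.MathematicalPhysics.QuantumFieldTheory.Balaban1983to89.B8SockP5uEProviderGamma

/-!
# `Balaban1983to89.B8SockSP5ThresholdsSrcGamma` — [Balaban1985RegularSpaces] Prop. 5 p. 94 («c₂, c₃») ∕ Thm 4 p. 88 («c₁») ∕ Thm 8 (1.146) p. 101: THE N05 KNIT's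
# THREE SOURCED PROP-5 SOCKETS `SP5`, `SP5base`, `SP5u` AT ONE MEMBER, EACH BELOW ONE THRESHOLD, EDITION γ — PRINT's BOX LAW «box ⊂ Ω_{j−1}» for the
# sourced b9 socket's class and the sockets' (1.35) antecedent in the p. 77 convention; dag-n05-d's `B8SockSP5ThresholdsSrc` re-run on the γ providers with
# ONE more threshold `c_γ(d, L, B₈)` for the five γ windows (`B8SockP5uEProviderGamma.gammaWindows_of_guard`)

statement-level skeleton of published theorems with citation tags; proofs where landed; nothing here is a claim about the Yang–Mills mass gap

T. Bałaban, *Spaces of regular gauge field configurations on a lattice and gauge fixing conditions*, Commun. Math. Phys. **99** (1985) 75–102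
`[Balaban1985RegularSpaces]` ("B8"; printed page = PDF page + 74): Prop. 5 (1.106)–(1.110) p. 94, Thm 4 p. 88, p. 95, (1.67)–(1.69) p. 88, (1.31) + (1.35) p. 82,
p. 77, Prop. 3 p. 87, (1.61) p. 86, Thm 8 (1.146) p. 101; [3] = [Balaban1985Averaging] Prop. 4 p. 36; [4] = [Balaban1985BackgroundPropagators] Thm 3.1 p. 397, (3.25)
p. 394, Thm 3.3 p. 398.  PDF held: `paper:balaban1985-cmp99-regular-spaces-gauge-fixing`.  STATUS: published, refereed.

CITATION HEADER (lean-in-tree rule).  Cell `pub-ymgap` (YM Track A, DAG node N05 = [B8], HUMAN RULING D-0062 ∕ D-0149 width seats), seat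
`pub-ymgap-dag-n05-w4` (g0): CLAIM-2 (cell bus 2026-08-27 l.24971), W-SEAT-START-LIST v3 §n05 item 4 («the Prop-5 sockets, m ≥ 1 obligation»).
WHY THIS FILE.  dag-n05-d's `B8SockSP5ThresholdsSrc` turns the three sourced socket providers into «∃ one threshold `c_P` (and one radius `c_u`)» statements by
discharging their displayed windows families from `B8SockWindowsSrc.hfpWindows_of_guard_src` ∕ `uniqWindows_of_guard_src`.  THIS FILE is the edition γ:
★ `exists_threshold_sp5_src_γ`, ★ `exists_threshold_sp5base_src_γ`, ★ `exists_threshold_sp5u_src_γ` — the parents VERBATIM except: the member's class law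
`hbox` under «box ⊂ Ω_{j−1}» ((1.31) p. 82); the sockets' (1.35) antecedent (in the CONCLUSIONS) in print's p. 77 guard «box ⊂ Ω (j − 1)»; the providers are the
γ ones (`sp5_of_sockLettersRD_src_γ`, `sp5base_of_sockLettersRD_src_γ`, `sp5uE_of_lettersUB_src_γ`); and the level-`m ≥ 1` thresholds take ONE more minimum,
`c_γ(d, L, B₈)` of `gammaWindows_of_guard`, which supplies the γ windows family `hwinγ`.  The knit's sourced b9 socket `SH59` is consumed in its own text.
Kind «kernel-checked proof», three theorems, no `def`, no existing module modified.

HONEST SCOPE ∕ A6.  Assembly by name + one more `min`; [4]'s letters (`SLet`∕`SLetUB`), the sourced b9 socket `SH59` over the PARAMETRIC class `Λb` (false over a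
«box ⊂ Ω_j» class at nested members by dag-n05-c p572834 ∕ p576185; = print's sourced (1.59) over `cubeLamBP'` ∕ `towerBondsP`, open; N06 content at `m ≥ 1`)
are displayed HYPOTHESES; no joint-satisfiability claim; `Ω 0 = univ` for `SP5u`; `d ≥ 2`, `L ≥ 2`.  Count-neutral; N05 NOT discharged; no count claim; one
finite `𝕋⁴` programme at fixed `ε`, Bałaban as printed; the Yang–Mills mass gap (Clay) is NOT proved by any of this — R4 closes the conditional finite-`𝕋⁴` rung
`BalabanLadder.UV` only; nothing continuum ∕ ℝ⁴ ∕ OS.  No `sorry`, no `def`, no `instance`, no `notation`.  Unit `pub-ymgap-dag-n05-w4` (g0), 2026-08-28.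

RELATED IN THE TREE, NOT DUPLICATED: `B8SockSP5ThresholdsSrc` (dag-n05-d; «box ⊂ Ω_j» edition), `B8SockWindowsSrc` (dag-n05-d; the sourced windows lemmas —
USED), `B8SockSP5ProviderSrcGamma` ∕ `B8SockSP5BaseSrcGamma` ∕ `B8SockSP5uProviderSrcGamma` ∕ `B8SockP5uEProviderGamma` (this seat; USED),
`B8SockSP5UniformThresholdsSrc` (dag-n05-d; the member-uniform thresholds — edition γ in `B8SockSP5UniformThresholdsSrcGamma`).
-/

noncomputable section

open NormedSpace

namespace Literature.MathematicalPhysics.QuantumFieldTheory.Balaban1983to89.B8SockSP5ThresholdsSrcGamma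

open Complex (I)
open MatrixLog B7Prop1Explicit B7Prop2Explicit B7Prop1Local B7Eq92Concrete
open B7Prop2Explicit (C0 c2')
open B7Prop3Flat (c3)
open B7Prop10General (C6 C4G)
open B7Prop9Flat (C5')
open B7Eq78Linearization (conjR zdBlocking QprimeIter)
open B8Ineq132 (covDerivFwd covDeriv InAk)
open B8Eq119TwistedAxial (Restr129 InAx bgT)
open B8Eq184Proof (gaugeExp cfgExp)
open B8Lemma1NonAbelian (mulCfg)
open B8Eq140Level (SideTouches)
open B8Eq146AExpansion (iEta expCfg)
open B8Ineq130 (tlo thi)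
open B8Thm2LogB (blockTop)
open B8Eq138LandauZd (InR138 covDivB covLap QT logCfg)
open B8Ineq125Concrete (C2p)
open B8Eq1117Concrete (XSpace)
open B8Eq155JBound (Jcur wsup)
open B7Prop4GeneralLevels (linCovIter)
open B8ScaledSupNorm (bondNorm msup Bdd)
open B8Prop5ContractionKLevel (Bd2 Mc Kc)
open B8LambdaSpaceKLevel (wt)
open B8SockLettersRD (SockLettersRD)
open B8LanF146 (LanF146)
open B8SockSP5ProviderSrc (sp5_of_sockLettersRD_src)
open B8SockSP5BaseSrc (sp5base_of_sockLettersRD_src)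
open B8SockSP5uProviderSrc (sp5uE_of_lettersUB_src)
open B8SockWindowsSrc (hfpWindows_of_guard_src uniqWindows_of_guard_src)
open QuantumLattice (blockSites)

-- `Site` alone could resolve to the torus sites of `Setup.lean`; re-export the `ℤ^d` sites of `B7Prop1Explicit`.
export B7Prop1Explicit (Site)

variable {d : ℕ} {𝔸 : Type*} [CStarAlgebra 𝔸] [Nontrivial 𝔸]
variable {L : ℕ} {η : ℝ} {k : ℕ} {Ω : ℕ → Set (Site d)} {Λs : ℕ → ℕ → Set (Site d)} {Λb : ℕ → ℕ → Set (Site d × Fin d)}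
  {B₀ B₀' B₈ B₀'H B₂' BG BR cL γ γ' : ℝ}

open B8SockSP5ProviderSrcGamma (sp5_of_sockLettersRD_src_γ)
open B8SockSP5BaseSrcGamma (sp5base_of_sockLettersRD_src_γ)
open B8SockSP5uProviderSrcGamma (sp5uE_of_lettersUB_src_γ)
open B8SockP5uEProviderGamma (gammaWindows_of_guard)

/-- ★ **EDITION γ (`hbox` under «box ⊂ Ω_{j−1}»; the conclusion's (1.35) antecedent in the p. 77 guard; one more threshold `c_γ` for the five γ windows, `B8SockP5uEProviderGamma.gammaWindows_of_guard` at `B₈`; provider `B8SockSP5ProviderSrcGamma.sp5_of_sockLettersRD_src_γ`) OF: **THE KNIT's SOURCED SOCKET `SP5` AT ONE MEMBER, BELOW ONE THRESHOLD** (Theorem 4's «there exists a constant c₁» for Proposition 5 at Theorem 8's gauge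
condition): `B8SockSP5ProviderSrc.sp5_of_sockLettersRD_src` with its windows family discharged by `B8SockWindowsSrc.hfpWindows_of_guard_src`
(`c_P := min(c_W, c_L, c₅₉)`).
[cite: Balaban1985RegularSpaces, Thm 4 p.88 («there exists a constant c₁»), Prop. 5 (1.106)–(1.108) p.94, Thm 8 (1.146) p.101; Balaban1985BackgroundPropagators, Thm 3.1 p.397, Thm 3.3 p.398] -/
theorem exists_threshold_sp5_src_γ (hd2 : 2 ≤ d) (hL : 2 ≤ L) (hη : 0 < η) (hΩ : ∀ j, Ω (j + 1) ⊆ Ω j)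
    (hB8two : 2 ≤ 5 * (d : ℝ) * L * B₈) (hfree : 3 * (2 * (d : ℝ) * (L : ℝ) ^ 2) * BG * BR * (B₈ + γ) ≤ B₀' * B₈) (hcL : 0 < cL)
    -- PRINT's box law: the locality box of a datum bond of level `j` lies in `Ω_{j−1}` ((1.31); level 0: `Ω₀`)
    (hbox : ∀ m, m ≤ k → ∀ j, j ≤ m → ∀ c ∈ Λb m j, ∀ x, InBox (loK L j c.1) (bondHiK L j c.1 c.2) x → x ∈ Ω (j - 1))
    (hclass : ∀ m, m ≤ k → ∀ j, j ≤ m → ∀ c ∈ Λb m j,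
      (c.1 ∈ Λs m j ∧ c.1 + e c.2 ∈ Λs m j) ∨
      (∃ j', j = j' + 1 ∧ (∀ x, (L : ℤ) • c.1 ≤ x → x ≤ (L : ℤ) • c.1 + blockTop L → x ∈ Λs m j') ∧ c.1 + e c.2 ∈ Λs m j) ∨
      (∃ j', j = j' + 1 ∧ c.1 ∈ Λs m j ∧ (∀ x, (L : ℤ) • (c.1 + e c.2) ≤ x → x ≤ (L : ℤ) • (c.1 + e c.2) + blockTop L → x ∈ Λs m j')))
    (htw : ∀ m, m ≤ k → ∀ j, j ≤ m → ∀ y ∈ Λs m j, ∀ x, InBox (tlo L y j) (thi L y j) x → x ∈ Ω j)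
    (h8lt : ∀ m, m < k → ∀ j, j < m → Λs m j = Λs (m + 1) j)
    (h8top : ∀ m, m < k → ∀ x, x ∈ Λs m m ↔ x ∈ Λs (m + 1) m ∨ ∃ y ∈ Λs (m + 1) (m + 1), x ∈ blockSites L y)
    (hB₀ : 0 < B₀) (hB₀' : 0 < B₀') (hB₀'H : 0 < B₀'H) (hB₂' : 0 ≤ B₂') (hBG : 0 ≤ BG) (hBR : 0 ≤ BR) (hγ : 0 ≤ γ) (hγ' : 0 ≤ γ')
    (hB₀8 : B₀ ≤ B₈) (hγB : 2 * (γ' * B₀) ≤ 5 * (d : ℝ) * L * B₈)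
    (SLet : SockLettersRD (𝔸 := 𝔸) L BG BR B₀'H B₂' cL η k Ω Λs)
    -- THE SOURCED b9 SOCKET AT THIS MEMBER (the knit's `SH59src` at `LanF := LanF146`)
    {c59 : ℝ} (hc59 : 0 < c59)
    (SH59 : ∀ α₀ α₁ : ℝ, 0 < α₀ → 0 < α₁ → α₀ + α₁ ≤ c59 →
      ∀ U₀ U' : Site d → Fin d → 𝔸ˣ, (∀ x κ, U₀ x κ ∈ unitaryUnits 𝔸) → (∀ x κ, U' x κ ∈ unitaryUnits 𝔸) →
      ∀ φ : Site d → 𝔸, ((InR138 L k η (Ω 0) (Λs k) U₀ φ ∧ (∀ x, IsSelfAdjoint (φ x)) ∧ (∀ x, x ∉ Ω 0 → φ x = 0) ∧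
          Bdd L k η (-(2 : ℝ)) (fun j (x : Site d) => x ∈ Ω j) φ) ∧
        msup L k η (-(2 : ℝ)) (fun j (x : Site d) => x ∈ Ω j) φ < γ * (α₀ + α₁)) →
      InAk L k η α₀ Ω U₀ → InAk L k η α₀ Ω (mulCfg U' U₀) → (∀ m, m ≤ k → InAx L m (Λs m) U₀ (mulCfg U' U₀)) →
      (∀ j, j ≤ k → ∀ (z : Site d) (μ : Fin d), (∀ x, InBox (loK L j z) (bondHiK L j z μ) x → x ∈ Ω j) →
        ‖(avgIter L (mulCfg U' U₀) j z μ : 𝔸) - (avgIter L U₀ j z μ : 𝔸)‖ ≤ α₁) →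
      (∀ b ∈ {b : Site d × Fin d | SideTouches (Ω 0) b.1 b.2}, ‖((U' b.1 b.2 : 𝔸ˣ) : 𝔸) - 1‖ ≤ α₁) →
      (∀ m, 1 ≤ m → m ≤ k → ∀ (u : Site d → 𝔸ˣ) (W : Site d → Fin d → 𝔸ˣ) (A' : Site d → Fin d → 𝔸),
        (∀ x, u x ∈ unitaryUnits 𝔸) → mgauge U₀ u W = U' → Restr129 L m (Λs m) U₀ u → LanF146 L k η (Ω 0) Λs U₀ φ m W →
        (∀ y τ, IsSelfAdjoint (A' y τ)) →
        (∀ j, j ≤ m → ∀ y τ, SideTouches (Ω j) y τ →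
        W y τ = cfgExp η A' y τ ∧ ‖A' y τ‖ ≤ (2 * (L * (5 * (d : ℝ) * L * B₈ * (α₀ + α₁))) + 8 * (8 * B₀' * (5 * (d : ℝ) * L * B₈) * (α₀ + α₁))) * ((L : ℝ) ^ j * η)⁻¹) →
        (∀ y τ, (∀ j, j ≤ m → ¬ SideTouches (Ω j) y τ) → A' y τ = 0) →
        msup L m η (-(1 : ℝ)) (fun j (b : Site d × Fin d) => SideTouches (Ω j) b.1 b.2) (fun b => A' b.1 b.2)
        ≤ B₀ * (bondNorm L m η (-(3 : ℝ)) Ω (fun x μ => Jcur η U₀ A' μ x)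
        + wsup 1 (fun p : {p : ℕ × (Site d × Fin d) // p.1 ≤ m ∧ p.2 ∈ Λb m p.1} =>
        linCovIter L U₀ (iEta η A') p.1.1 p.1.2.1 p.1.2.2)) + γ' * B₀ * (α₀ + α₁) ∧
        msup L m η (-(2 : ℝ)) (fun j (t : Fin d × Fin d × Site d) => SideTouches (Ω j) t.2.2 t.2.1)
        (fun t => covDerivFwd η U₀ t.1 (fun z => A' z t.2.1) t.2.2)
        ≤ B₀ * (bondNorm L m η (-(3 : ℝ)) Ω (fun x μ => Jcur η U₀ A' μ x)
        + wsup 1 (fun p : {p : ℕ × (Site d × Fin d) // p.1 ≤ m ∧ p.2 ∈ Λb m p.1} =>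
        linCovIter L U₀ (iEta η A') p.1.1 p.1.2.1 p.1.2.2)) + γ' * B₀ * (α₀ + α₁))) :
    ∃ cP : ℝ, 0 < cP ∧
    ∀ α₀ α₁ : ℝ, 0 < α₀ → 0 < α₁ → α₀ + α₁ ≤ cP →
      ∀ U₀ U' : Site d → Fin d → 𝔸ˣ, (∀ x κ, U₀ x κ ∈ unitaryUnits 𝔸) → (∀ x κ, U' x κ ∈ unitaryUnits 𝔸) →
      ∀ φ : Site d → 𝔸, ((InR138 L k η (Ω 0) (Λs k) U₀ φ ∧ (∀ x, IsSelfAdjoint (φ x)) ∧ (∀ x, x ∉ Ω 0 → φ x = 0) ∧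
          Bdd L k η (-(2 : ℝ)) (fun j (x : Site d) => x ∈ Ω j) φ) ∧
        msup L k η (-(2 : ℝ)) (fun j (x : Site d) => x ∈ Ω j) φ < γ * (α₀ + α₁)) →
      InAk L k η α₀ Ω U₀ → InAk L k η α₀ Ω (mulCfg U' U₀) → (∀ m, m ≤ k → InAx L m (Λs m) U₀ (mulCfg U' U₀)) →
      (∀ j, j ≤ k → ∀ (z : Site d) (μ : Fin d), (∀ x, InBox (loK L j z) (bondHiK L j z μ) x → x ∈ Ω (j - 1)) →
        ‖(avgIter L (mulCfg U' U₀) j z μ : 𝔸) - (avgIter L U₀ j z μ : 𝔸)‖ ≤ α₁) →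
      (∀ b ∈ {b : Site d × Fin d | SideTouches (Ω 0) b.1 b.2}, ‖((U' b.1 b.2 : 𝔸ˣ) : 𝔸) - 1‖ ≤ α₁) →
      (∀ m, 1 ≤ m → m < k → ∀ (u₁ : Site d → 𝔸ˣ) (U₁ : Site d → Fin d → 𝔸ˣ) (A : Site d → Fin d → 𝔸),
        (∀ x, u₁ x ∈ unitaryUnits 𝔸) → (∀ x, x ∉ Ω 0 → u₁ x = 1) → mgauge U₀ u₁ U₁ = U' → Restr129 L m (Λs m) U₀ u₁ →
        LanF146 L k η (Ω 0) Λs U₀ φ m U₁ →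
        (∀ j, j ≤ m → ∀ b ∈ {b : Site d × Fin d | SideTouches (Ω j) b.1 b.2},
        U₁ b.1 b.2 = cfgExp η A b.1 b.2 ∧ IsSelfAdjoint (A b.1 b.2) ∧ ‖A b.1 b.2‖ ≤ (5 * (d : ℝ) * L * B₈ * (α₀ + α₁)) * ((L : ℝ) ^ j * η)⁻¹) →
        ∃ (v : Site d → 𝔸ˣ) (lam : Site d → 𝔸), (∀ x, v x ∈ unitaryUnits 𝔸) ∧ (∀ x, x ∉ Ω 0 → v x = 1) ∧
        (∀ j, j ≤ m + 1 → ∀ b ∈ {b : Site d × Fin d | SideTouches (Ω j) b.1 b.2}, (v b.1 : 𝔸) = ((gaugeExp lam b.1 : 𝔸ˣ) : 𝔸) ∧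
        (v (b.1 + e b.2) : 𝔸) = ((gaugeExp lam (b.1 + e b.2) : 𝔸ˣ) : 𝔸)) ∧
        (∀ j, j ≤ m + 1 → ∀ b ∈ {b : Site d × Fin d | SideTouches (Ω j) b.1 b.2},
        ‖lam b.1‖ ≤ (8 * B₀' * (5 * (d : ℝ) * L * B₈) * (α₀ + α₁)) ∧ ((L : ℝ) ^ j * η) * ‖covDerivFwd η U₀ b.2 lam b.1‖ ≤ (8 * B₀' * (5 * (d : ℝ) * L * B₈) * (α₀ + α₁))) ∧
        LanF146 L k η (Ω 0) Λs U₀ φ (m + 1) (mgauge U₀ v⁻¹ U₁) ∧ Restr129 L (m + 1) (Λs (m + 1)) U₀ (u₁ * v)) := by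
  have hL1 : 1 ≤ L := le_trans (by norm_num) hL
  have hd1 : 1 ≤ d := le_trans (by norm_num) hd2
  have hB₈ : 0 < B₈ := lt_of_lt_of_le hB₀ hB₀8
  obtain ⟨cW, hcW, hW⟩ := hfpWindows_of_guard_src hd1 hL1 hB₈ hB₀' hB8two hB₀'H hB₂' hBG hBR hγ hfree
  -- EDITION γ: the five γ windows from one more threshold `c_γ(d, L, B₈)`
  obtain ⟨cγ, hcγ, hWγ⟩ := gammaWindows_of_guard (d := d) hd1 hL1 hB₈
  refine ⟨min cW (min cL (min c59 cγ)), lt_min hcW (lt_min hcL (lt_min hc59 hcγ)), ?_⟩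
  have hPW : min cW (min cL (min c59 cγ)) ≤ cW := min_le_left _ _
  have hPL : min cW (min cL (min c59 cγ)) ≤ cL := (min_le_right _ _).trans (min_le_left _ _)
  have hP59 : min cW (min cL (min c59 cγ)) ≤ c59 := (min_le_right _ _).trans ((min_le_right _ _).trans (min_le_left _ _))
  have hPγ : min cW (min cL (min c59 cγ)) ≤ cγ := (min_le_right _ _).trans ((min_le_right _ _).trans (min_le_right _ _))
  exact sp5_of_sockLettersRD_src_γ hd2 hL hη hΩ hbox hclass htw h8lt h8top hB₀ hB₀' hB₀'H hB₂' hBG hBR hγ hγ' hB₀8 hγB SLet hPL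
    (fun α₀ α₁ hα₀ hα₁ hs => SH59 α₀ α₁ hα₀ hα₁ (hs.trans hP59))
    (fun α₀ α₁ hα₀ hα₁ hs cs α₄ cB cDA hE hE₂ lE lE₂ e1 e2 e3 e4 e5 e6 e7 e8 => by
      obtain ⟨w1, w2, w3, w4, w5, w6, w7, w8, w9, w10, w11, w12, w13, w14, w15, w16, w17, w18, w19, w20, w21, w22, w23, w24, w25, w26, w27, -⟩ :=
        hW α₀ α₁ hα₀ hα₁ (hs.trans hPW) cs α₄ cB cDA hE hE₂ lE lE₂ e1 e2 e3 e4 e5 e6 e7 e8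
      exact ⟨w1, w2, w3, w4, w5, w6, w7, w8, w9, w10, w11, w12, w13, w14, w15, w16, w17, w18, w19, w20, w21, w22, w23, w24, w25, w26, w27⟩)
    (fun α₀ α₁ hα₀ hα₁ hs => hWγ α₀ α₁ hα₀ hα₁ (hs.trans hPγ))

/-- ★ **EDITION γ (the conclusion's (1.35) antecedent in the p. 77 guard; provider `B8SockSP5BaseSrcGamma.sp5base_of_sockLettersRD_src_γ`; no class∕b9 read at the base) OF: **THE KNIT's SOURCED BASE SOCKET `SP5base` AT ONE MEMBER, BELOW ONE THRESHOLD**: `B8SockSP5BaseSrc.sp5base_of_sockLettersRD_src` with its windows family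
discharged by `B8SockWindowsSrc.hfpWindows_of_guard_src` (`c_P := min(c_W, c_L)`; no b9 socket is read at the base).
[cite: Balaban1985RegularSpaces, Thm 4 p.88 («there exists a constant c₁»), Prop. 5 p.94, p.95 («For j = 0 we apply simply Proposition 5»), Thm 8 (1.146) p.101] -/
theorem exists_threshold_sp5base_src_γ (hd2 : 2 ≤ d) (hL : 2 ≤ L) (hη : 0 < η) (hk : 1 ≤ k) (hΩ : ∀ j, Ω (j + 1) ⊆ Ω j)
    (hfree : 3 * (2 * (d : ℝ) * (L : ℝ) ^ 2) * BG * BR * (B₈ + γ) ≤ B₀' * B₈) (hcL : 0 < cL)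
    (htw : ∀ m, m ≤ k → ∀ j, j ≤ m → ∀ y ∈ Λs m j, ∀ x, InBox (tlo L y j) (thi L y j) x → x ∈ Ω j)
    (hB₀' : 0 < B₀') (hB₀'H : 0 < B₀'H) (hB₂' : 0 ≤ B₂') (hBG : 0 ≤ BG) (hBR : 0 ≤ BR) (hγ : 0 ≤ γ) (hB₈ : 0 < B₈)
    (hB8two : 2 ≤ 5 * (d : ℝ) * L * B₈)
    (SLet : SockLettersRD (𝔸 := 𝔸) L BG BR B₀'H B₂' cL η k Ω Λs) :
    ∃ cP : ℝ, 0 < cP ∧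
    ∀ α₀ α₁ : ℝ, 0 < α₀ → 0 < α₁ → α₀ + α₁ ≤ cP →
      ∀ U₀ U' : Site d → Fin d → 𝔸ˣ, (∀ x κ, U₀ x κ ∈ unitaryUnits 𝔸) → (∀ x κ, U' x κ ∈ unitaryUnits 𝔸) →
      ∀ φ : Site d → 𝔸, ((InR138 L k η (Ω 0) (Λs k) U₀ φ ∧ (∀ x, IsSelfAdjoint (φ x)) ∧ (∀ x, x ∉ Ω 0 → φ x = 0) ∧
          Bdd L k η (-(2 : ℝ)) (fun j (x : Site d) => x ∈ Ω j) φ) ∧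
        msup L k η (-(2 : ℝ)) (fun j (x : Site d) => x ∈ Ω j) φ < γ * (α₀ + α₁)) →
      InAk L k η α₀ Ω U₀ → InAk L k η α₀ Ω (mulCfg U' U₀) → (∀ m, m ≤ k → InAx L m (Λs m) U₀ (mulCfg U' U₀)) →
      (∀ j, j ≤ k → ∀ (z : Site d) (μ : Fin d), (∀ x, InBox (loK L j z) (bondHiK L j z μ) x → x ∈ Ω (j - 1)) →
        ‖(avgIter L (mulCfg U' U₀) j z μ : 𝔸) - (avgIter L U₀ j z μ : 𝔸)‖ ≤ α₁) →
      (∀ b ∈ {b : Site d × Fin d | SideTouches (Ω 0) b.1 b.2}, ‖((U' b.1 b.2 : 𝔸ˣ) : 𝔸) - 1‖ ≤ α₁) →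
      (∃ (v : Site d → 𝔸ˣ) (lam : Site d → 𝔸), (∀ x, v x ∈ unitaryUnits 𝔸) ∧ (∀ x, x ∉ Ω 0 → v x = 1) ∧
        (∀ j, j ≤ 1 → ∀ b ∈ {b : Site d × Fin d | SideTouches (Ω j) b.1 b.2}, (v b.1 : 𝔸) = ((gaugeExp lam b.1 : 𝔸ˣ) : 𝔸) ∧
        (v (b.1 + e b.2) : 𝔸) = ((gaugeExp lam (b.1 + e b.2) : 𝔸ˣ) : 𝔸)) ∧
        (∀ j, j ≤ 1 → ∀ b ∈ {b : Site d × Fin d | SideTouches (Ω j) b.1 b.2},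
        ‖lam b.1‖ ≤ (8 * B₀' * (5 * (d : ℝ) * L * B₈) * (α₀ + α₁)) ∧ ((L : ℝ) ^ j * η) * ‖covDerivFwd η U₀ b.2 lam b.1‖ ≤ (8 * B₀' * (5 * (d : ℝ) * L * B₈) * (α₀ + α₁))) ∧
        LanF146 L k η (Ω 0) Λs U₀ φ 1 (mgauge U₀ v⁻¹ U') ∧ Restr129 L 1 (Λs 1) U₀ ((1 : Site d → 𝔸ˣ) * v)) := by
  have hL1 : 1 ≤ L := le_trans (by norm_num) hL
  have hd1 : 1 ≤ d := le_trans (by norm_num) hd2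
  obtain ⟨cW, hcW, hW⟩ := hfpWindows_of_guard_src hd1 hL1 hB₈ hB₀' hB8two hB₀'H hB₂' hBG hBR hγ hfree
  refine ⟨min cW cL, lt_min hcW hcL, ?_⟩
  exact sp5base_of_sockLettersRD_src_γ hd2 hL hη hk hΩ htw hB₀' hB₀'H hB₂' hBG hBR hγ hB₈ hB8two SLet (min_le_right _ _)
    (fun α₀ α₁ hα₀ hα₁ hs cs α₄ cB cDA hE hE₂ lE lE₂ e1 e2 e3 e4 e5 e6 e7 e8 => by
      obtain ⟨-, -, -, -, w5, w6, w7, w8, w9, w10, w11, w12, w13, w14, w15, w16, w17, w18, w19, w20, w21, w22, w23, w24, w25, w26, w27, w28⟩ :=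
        hW α₀ α₁ hα₀ hα₁ (hs.trans (min_le_left _ _)) cs α₄ cB cDA hE hE₂ lE lE₂ e1 e2 e3 e4 e5 e6 e7 e8
      exact ⟨w5, w6, w7, w8, w9, w10, w11, w12, w13, w14, w15, w16, w17, w18, w19, w20, w21, w22, w23, w24, w25, w26, w27, w28⟩)

/-- ★ **EDITION γ (`hbox` under «box ⊂ Ω_{j−1}»; the conclusion's (1.35) antecedent in the p. 77 guard = `SockP5uEγ`'s text at (1.146); one more threshold `c_γ` for the γ windows; provider `B8SockSP5uProviderSrcGamma.sp5uE_of_lettersUB_src_γ`) OF: **THE KNIT's SOURCED UNIQUENESS SOCKET `SP5u` (E CURRENCY) AT ONE `Ω 0 = univ` MEMBER, AT ONE RADIUS, BELOW ONE THRESHOLD** (print's «c₂, c₃»):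
`B8SockSP5uProviderSrc.sp5uE_of_lettersUB_src` with its windows family discharged by `B8SockWindowsSrc.uniqWindows_of_guard_src`
(`c_u` and `α₄` from the windows lemma, `c_P := min(c_W, c_L, c₅₉)`).
[cite: Balaban1985RegularSpaces, Prop. 5 (1.109) p.94 («c₂, c₃»; «unique in the domain |λ|, |Dλ|₍₋₁₎ < c₃»), Thm 4 p.88 («exactly one»), Thm 8 (1.146) p.101] -/
theorem exists_threshold_sp5u_src_γ (hd2 : 2 ≤ d) (hL : 2 ≤ L) (hη : 0 < η) (hk : 1 ≤ k) (hΩ : ∀ j, Ω (j + 1) ⊆ Ω j) (hΩ0 : Ω 0 = Set.univ)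
    (hB8two : 2 ≤ 5 * (d : ℝ) * L * B₈) (hcL : 0 < cL)
    -- PRINT's box law: the locality box of a datum bond of level `j` lies in `Ω_{j−1}` ((1.31); level 0: `Ω₀`)
    (hbox : ∀ m, m ≤ k → ∀ j, j ≤ m → ∀ c ∈ Λb m j, ∀ x, InBox (loK L j c.1) (bondHiK L j c.1 c.2) x → x ∈ Ω (j - 1))
    (hclass : ∀ m, m ≤ k → ∀ j, j ≤ m → ∀ c ∈ Λb m j,
      (c.1 ∈ Λs m j ∧ c.1 + e c.2 ∈ Λs m j) ∨
      (∃ j', j = j' + 1 ∧ (∀ x, (L : ℤ) • c.1 ≤ x → x ≤ (L : ℤ) • c.1 + blockTop L → x ∈ Λs m j') ∧ c.1 + e c.2 ∈ Λs m j) ∨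
      (∃ j', j = j' + 1 ∧ c.1 ∈ Λs m j ∧ (∀ x, (L : ℤ) • (c.1 + e c.2) ≤ x → x ≤ (L : ℤ) • (c.1 + e c.2) + blockTop L → x ∈ Λs m j')))
    (htower : ∀ j, j ≤ k → ∀ y ∈ Λs k j, ∀ x, InBox (tlo L y j) (thi L y j) x → x ∈ Ω j)
    (hB₀ : 0 < B₀) (hB₀' : 0 < B₀') (hB₀'H : 0 < B₀'H) (hB₂' : 0 ≤ B₂') (hBG : 0 ≤ BG) (hBR : 0 ≤ BR) (hγ : 0 ≤ γ) (hγ' : 0 ≤ γ')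
    (hB₀8 : B₀ ≤ B₈) (hγB : 2 * (γ' * B₀) ≤ 5 * (d : ℝ) * L * B₈)
    -- (i) [4]'s uniqueness letters at the top structure `(k, Λs k, U₀)`, left-inverse law of `G′` on bounded functions
    (SLetUB : ∀ α₀ : ℝ, 0 < α₀ → α₀ ≤ cL → ∀ U₀ : Site d → Fin d → 𝔸ˣ, (∀ x κ, U₀ x κ ∈ unitaryUnits 𝔸) → InAk L k η α₀ Ω U₀ →
      ∃ (g Δ : (Site d → 𝔸) →ₗ[ℂ] (Site d → 𝔸)) (q : (Site d → 𝔸) →ₗ[ℂ] (ℕ → Site d → 𝔸)) (qs : (ℕ → Site d → 𝔸) →ₗ[ℂ] (Site d → 𝔸))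
        (Aw c : (ℕ → Site d → 𝔸) →ₗ[ℂ] (ℕ → Site d → 𝔸)) (H' : XSpace d k 𝔸 →ₗ[ℂ] (Site d → 𝔸)),
        (∀ x : Site d → 𝔸, (∃ C : ℝ, ∀ y, ‖x y‖ ≤ C) → g (Δ x + qs (Aw (q x))) = x) ∧ (∀ φ, qs (c (q (g (g (qs φ))))) = qs φ) ∧
        (∀ (f : Site d → 𝔸), ∀ x ∈ Ω 0, Δ f x = covLap η U₀ ((Ω 0).indicator f) x) ∧
        (∀ (μ : ℕ → Site d → 𝔸), ∀ x ∈ Ω 0, qs μ x = QT L k (Λs k) U₀ μ x) ∧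
        (∀ (f : Site d → 𝔸) (j : ℕ), j ≤ k → ∀ y ∈ Λs k j, q f j y = QprimeIter (zdBlocking d L) (bgT L U₀) j f y) ∧
        (∀ (f : Site d → 𝔸) (j : ℕ) (y : Site d), ¬ (j ≤ k ∧ y ∈ Λs k j) → q f j y = 0) ∧
        (∀ (X : XSpace d k 𝔸) (x : Site d), ‖H' X x‖ ≤ B₀'H * ‖X‖) ∧
        (∀ j, j ≤ k → ∀ (X : XSpace d k 𝔸), ∀ p ∈ {b : Site d × Fin d | SideTouches (Ω j) b.1 b.2},
          wt L η j * ‖covDerivFwd η U₀ p.2 (H' X) p.1‖ ≤ B₀'H * ‖X‖) ∧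
        (∀ X : XSpace d k 𝔸, Bd2 L η k Ω (covLap η U₀ (H' X)) (B₂' * ‖X‖)) ∧
        (∀ (Y : XSpace d k 𝔸) (j : ℕ) (hj : j ≤ k) (y : Site d), y ∈ Λs k j →
          QprimeIter (zdBlocking d L) (bgT L U₀) j (H' Y) y = Y (⟨j, Nat.lt_succ_of_le hj⟩, y)) ∧
        (∀ (f : Site d → 𝔸) (r : ℝ), 0 ≤ r → Bd2 L η k Ω f r →
          (∀ x, ‖g f x‖ ≤ BG * r) ∧ ∀ j, j ≤ k → ∀ p ∈ {b : Site d × Fin d | SideTouches (Ω j) b.1 b.2},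
            wt L η j * ‖covDerivFwd η U₀ p.2 (g f) p.1‖ ≤ BG * r) ∧
        (∀ (f : Site d → 𝔸) (r : ℝ), 0 ≤ r → Bd2 L η k Ω f r → Bd2 L η k Ω (f - g (qs (c (q (g f))))) (BR * r)))
    -- (ii) THE SOURCED b9 SOCKET AT THIS MEMBER (the knit's `SH59src` at `LanF := LanF146`)
    {c59 : ℝ} (hc59 : 0 < c59)
    (SH59 : ∀ α₀ α₁ : ℝ, 0 < α₀ → 0 < α₁ → α₀ + α₁ ≤ c59 →
      ∀ U₀ U' : Site d → Fin d → 𝔸ˣ, (∀ x κ, U₀ x κ ∈ unitaryUnits 𝔸) → (∀ x κ, U' x κ ∈ unitaryUnits 𝔸) →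
      ∀ φ : Site d → 𝔸, ((InR138 L k η (Ω 0) (Λs k) U₀ φ ∧ (∀ x, IsSelfAdjoint (φ x)) ∧ (∀ x, x ∉ Ω 0 → φ x = 0) ∧
          Bdd L k η (-(2 : ℝ)) (fun j (x : Site d) => x ∈ Ω j) φ) ∧
        msup L k η (-(2 : ℝ)) (fun j (x : Site d) => x ∈ Ω j) φ < γ * (α₀ + α₁)) →
      InAk L k η α₀ Ω U₀ → InAk L k η α₀ Ω (mulCfg U' U₀) → (∀ m, m ≤ k → InAx L m (Λs m) U₀ (mulCfg U' U₀)) →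
      (∀ j, j ≤ k → ∀ (z : Site d) (μ : Fin d), (∀ x, InBox (loK L j z) (bondHiK L j z μ) x → x ∈ Ω j) →
        ‖(avgIter L (mulCfg U' U₀) j z μ : 𝔸) - (avgIter L U₀ j z μ : 𝔸)‖ ≤ α₁) →
      (∀ b ∈ {b : Site d × Fin d | SideTouches (Ω 0) b.1 b.2}, ‖((U' b.1 b.2 : 𝔸ˣ) : 𝔸) - 1‖ ≤ α₁) →
      (∀ m, 1 ≤ m → m ≤ k → ∀ (u : Site d → 𝔸ˣ) (W : Site d → Fin d → 𝔸ˣ) (A' : Site d → Fin d → 𝔸),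
        (∀ x, u x ∈ unitaryUnits 𝔸) → mgauge U₀ u W = U' → Restr129 L m (Λs m) U₀ u → LanF146 L k η (Ω 0) Λs U₀ φ m W →
        (∀ y τ, IsSelfAdjoint (A' y τ)) →
        (∀ j, j ≤ m → ∀ y τ, SideTouches (Ω j) y τ →
        W y τ = cfgExp η A' y τ ∧ ‖A' y τ‖ ≤ (2 * (L * (5 * (d : ℝ) * L * B₈ * (α₀ + α₁))) + 8 * (8 * B₀' * (5 * (d : ℝ) * L * B₈) * (α₀ + α₁))) * ((L : ℝ) ^ j * η)⁻¹) →
        (∀ y τ, (∀ j, j ≤ m → ¬ SideTouches (Ω j) y τ) → A' y τ = 0) →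
        msup L m η (-(1 : ℝ)) (fun j (b : Site d × Fin d) => SideTouches (Ω j) b.1 b.2) (fun b => A' b.1 b.2)
        ≤ B₀ * (bondNorm L m η (-(3 : ℝ)) Ω (fun x μ => Jcur η U₀ A' μ x)
        + wsup 1 (fun p : {p : ℕ × (Site d × Fin d) // p.1 ≤ m ∧ p.2 ∈ Λb m p.1} =>
        linCovIter L U₀ (iEta η A') p.1.1 p.1.2.1 p.1.2.2)) + γ' * B₀ * (α₀ + α₁) ∧
        msup L m η (-(2 : ℝ)) (fun j (t : Fin d × Fin d × Site d) => SideTouches (Ω j) t.2.2 t.2.1)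
        (fun t => covDerivFwd η U₀ t.1 (fun z => A' z t.2.1) t.2.2)
        ≤ B₀ * (bondNorm L m η (-(3 : ℝ)) Ω (fun x μ => Jcur η U₀ A' μ x)
        + wsup 1 (fun p : {p : ℕ × (Site d × Fin d) // p.1 ≤ m ∧ p.2 ∈ Λb m p.1} =>
        linCovIter L U₀ (iEta η A') p.1.1 p.1.2.1 p.1.2.2)) + γ' * B₀ * (α₀ + α₁))) :
    ∃ cu cP : ℝ, 0 < cu ∧ 0 < cP ∧
    -- THE ρ3 `SP5u` BINDER BODY AT THIS MEMBER (`SockP5uE L B₈ cP cu η k Ω Λs` with `IsLandau138W ↦ LanF146 … φ k`, source binder after `hU'`)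
    ∀ α₀ α₁ : ℝ, 0 < α₀ → 0 < α₁ → α₀ + α₁ ≤ cP →
      ∀ U₀ U' : Site d → Fin d → 𝔸ˣ, (∀ x κ, U₀ x κ ∈ unitaryUnits 𝔸) → (∀ x κ, U' x κ ∈ unitaryUnits 𝔸) →
      ∀ φ : Site d → 𝔸, ((InR138 L k η (Ω 0) (Λs k) U₀ φ ∧ (∀ x, IsSelfAdjoint (φ x)) ∧ (∀ x, x ∉ Ω 0 → φ x = 0) ∧
          Bdd L k η (-(2 : ℝ)) (fun j (x : Site d) => x ∈ Ω j) φ) ∧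
        msup L k η (-(2 : ℝ)) (fun j (x : Site d) => x ∈ Ω j) φ < γ * (α₀ + α₁)) →
      InAk L k η α₀ Ω U₀ → InAk L k η α₀ Ω (mulCfg U' U₀) → (∀ m, m ≤ k → InAx L m (Λs m) U₀ (mulCfg U' U₀)) →
      (∀ j, j ≤ k → ∀ (z : Site d) (μ : Fin d), (∀ x, InBox (loK L j z) (bondHiK L j z μ) x → x ∈ Ω (j - 1)) →
        ‖(avgIter L (mulCfg U' U₀) j z μ : 𝔸) - (avgIter L U₀ j z μ : 𝔸)‖ ≤ α₁) →
      (∀ b ∈ {b : Site d × Fin d | SideTouches (Ω 0) b.1 b.2}, ‖((U' b.1 b.2 : 𝔸ˣ) : 𝔸) - 1‖ ≤ α₁) →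
      ∀ u₁ : Site d → 𝔸ˣ, (∀ x, u₁ x ∈ unitaryUnits 𝔸) → (∀ x, x ∉ Ω 0 → u₁ x = 1) → Restr129 L k (Λs k) U₀ u₁ →
      LanF146 L k η (Ω 0) Λs U₀ φ k (mgauge U₀ u₁⁻¹ U') →
      (∃ A₁ : Site d → Fin d → 𝔸, ∀ j, j ≤ k → ∀ (x : Site d) (κ : Fin d), SideTouches (Ω j) x κ →
        mgauge U₀ u₁⁻¹ U' x κ = cfgExp η A₁ x κ ∧ ‖A₁ x κ‖ ≤ (5 * (d : ℝ) * L * B₈ * (α₀ + α₁)) * ((L : ℝ) ^ j * η)⁻¹) →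
      ∀ (v w : Site d → 𝔸ˣ) (lam mu : Site d → 𝔸),
      (∀ x, ((gaugeExp lam x : 𝔸ˣ) : 𝔸) = ((v x : 𝔸ˣ) : 𝔸) ∧ IsSelfAdjoint (lam x) ∧ ‖lam x‖ < cu) → (∀ x, x ∉ Ω 0 → lam x = 0) →
      (∀ j, j ≤ k → ∀ b ∈ {b : Site d × Fin d | SideTouches (Ω j) b.1 b.2}, ((L : ℝ) ^ j * η) * ‖covDerivFwd η U₀ b.2 lam b.1‖ < cu) →
      (∀ x, ((gaugeExp mu x : 𝔸ˣ) : 𝔸) = ((w x : 𝔸ˣ) : 𝔸) ∧ IsSelfAdjoint (mu x) ∧ ‖mu x‖ < cu) → (∀ x, x ∉ Ω 0 → mu x = 0) →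
      (∀ j, j ≤ k → ∀ b ∈ {b : Site d × Fin d | SideTouches (Ω j) b.1 b.2}, ((L : ℝ) ^ j * η) * ‖covDerivFwd η U₀ b.2 mu b.1‖ < cu) →
      LanF146 L k η (Ω 0) Λs U₀ φ k (mgauge U₀ v⁻¹ (mgauge U₀ u₁⁻¹ U')) → Restr129 L k (Λs k) U₀ (u₁ * v) →
      LanF146 L k η (Ω 0) Λs U₀ φ k (mgauge U₀ w⁻¹ (mgauge U₀ u₁⁻¹ U')) → Restr129 L k (Λs k) U₀ (u₁ * w) →
      ∀ x, v x = w x := by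
  have hL1 : 1 ≤ L := le_trans (by norm_num) hL
  have hd1 : 1 ≤ d := le_trans (by norm_num) hd2
  have hB₈ : 0 < B₈ := lt_of_lt_of_le hB₀ hB₀8
  obtain ⟨α₄, cu, cW, hα₄, hcu, hcW, hW⟩ := uniqWindows_of_guard_src hd1 hL1 hB₈ hB8two hB₀'H hB₂' hBG hBR hγ
  -- EDITION γ: the five γ windows from one more threshold `c_γ(d, L, B₈)`
  obtain ⟨cγ, hcγ, hWγ⟩ := gammaWindows_of_guard (d := d) hd1 hL1 hB₈
  refine ⟨cu, min cW (min cL (min c59 cγ)), hcu, lt_min hcW (lt_min hcL (lt_min hc59 hcγ)), ?_⟩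
  have hPW : min cW (min cL (min c59 cγ)) ≤ cW := min_le_left _ _
  have hPL : min cW (min cL (min c59 cγ)) ≤ cL := (min_le_right _ _).trans (min_le_left _ _)
  have hP59 : min cW (min cL (min c59 cγ)) ≤ c59 := (min_le_right _ _).trans ((min_le_right _ _).trans (min_le_left _ _))
  have hPγ : min cW (min cL (min c59 cγ)) ≤ cγ := (min_le_right _ _).trans ((min_le_right _ _).trans (min_le_right _ _))
  exact sp5uE_of_lettersUB_src_γ hd2 hL hη hk hΩ hΩ0 hbox hclass htower hB₀ hB₀' hB₀'H hB₂' hBG hBR hγ hγ' hB₀8 hγB hα₄ SLetUB hPL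
    (fun α₀ α₁ hα₀ hα₁ hs => SH59 α₀ α₁ hα₀ hα₁ (hs.trans hP59))
    (fun α₀ α₁ hα₀ hα₁ hs => hW α₀ α₁ hα₀ hα₁ (hs.trans hPW))
    (fun α₀ α₁ hα₀ hα₁ hs => hWγ α₀ α₁ hα₀ hα₁ (hs.trans hPγ))

#print axioms exists_threshold_sp5_src_γ
#print axioms exists_threshold_sp5base_src_γ
#print axioms exists_threshold_sp5u_src_γ

end Literature.MathematicalPhysics.QuantumFieldTheory.Balaban1983to89.B8SockSP5ThresholdsSrcGamma

end
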